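import Summits.HodgeConjecture.HodgeConjecture.Theorems.R90S9DefiniteXiMembershipCut   -- ★ p861479 (p04): the (AE-ⅱ) text `hRig` of `definiteXiMembership_of_ch14` and all of its D6 currency
import Summits.HodgeConjecture.HodgeConjecture.Theorems.R90S5EvpOfAeRouting          -- ★ p861517 (S5): E1 string currency for EVERY hermitian `H` — `clFinChoice`, `xiFamilyOfRecord`, `evpAtIntegralLevel`
import Literature.NumberTheory.Rogawski1990.Ch14Bridge                               -- ★ the §14.6 carpet `Ch14Sec6.GlobalData` (`Γ.thm1461`, `Γ.sec146_evp`, `Γ.sec146_partition`, `Γ.thm1464a`)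
import HarnessLib

/-!
# R90-TF · S9 «InnerForm-13.3.6 (c)» — (AE-ⅱ) JUNCTION CUT, THE ENGINE AT ONE INSTANCE — ROUTE-AGNOSTIC EDITION: (14.6.1) AS ONE INPUT (sibling of ★ `R90S9DefiniteAeRigidityCutGeneric`)
# (Rogawski 1990 §14.6: (14.6.1) ⟹ e.v.p. classification ∕ partition of `Π(G′)` ⟹ Thm. 14.6.4 `Π′ = Π′(ξ)`, read back at every non-split finite place)

Cell `hodgecm-mathlib`, crux H413 (`stmt-HodgeConjecture-24833`, lane `--supports … --as helper`), route of record `HCCMUnconditional` (no route verbs; count-neutral).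
Programme R90-TF (brief `director/R90-BRIEF.v2.md` 1f40d54518340a35), section S9 = InnerForm-13.3.6 (c) (base `R90-IF`); seat R90-IF-p06 (g0).
DEALT BY NAME: R90-IF-plan (g2) J8 RULING 2026-09-04T23:31:48Z (J8-R2, deal (δ6s) «the pay line re-derived on the STABLE route: first step `Ch14Bridge.thm1461_of_thm1451b hG hH61
hvan hvanH h51` instead of `thm1461_of_thm1451b_of_prop1362`») — THIS FILE is its engine half (S1): ★ `definiteAeRigidityAt_of_parts′` (p862472) with the TWELVE route binders
`SθG SθH h51 PSVanish PSVanishH MatchH h62 h38 hexH hH61 hvan hvanH` (Thm. 14.5.1 (b) + the Prop. 13.6.2-route expansions, consumed ONLY by the first proof line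
`have h61 := Ch14Bridge.thm1461_of_thm1451b_of_prop1362 …`) REPLACED by the ONE binder they produce, `(h61 : Γ.thm1461 Transfer TransferH)` — (14.6.1) at the datum, from ANY
producer: the stable route ★ `Ch14Bridge.thm1461_of_thm1451b hG hH hvan hvanH h51` (Prop. 13.6.1-readings on BOTH sides), the 13.6.2 route ★ `…_of_prop1362`, or a Literature token.
Everything else BYTEWISE ★ `definiteAeRigidityAt_of_parts′`; proof = its lines minus the first.  WHY A SIBLING: ★ bytes are frozen and the (δ6s) top file
`R90S9DefiniteAeRigidityStableRoute.lean` must not carry `MatchH h62 h38 hexH` (J8-R1: the G-side of record is STABLE `X.G.StableDiscreteExpansionG X.tr SθG PSVanish`, for which no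
instantiation of the 13.6.2-route binders exists — `hexH : ∀ f, PSVanish f → ∃ fH, PSVanishH fH ∧ MatchH f fH` is genuine Thm. 13.3.8 content).  THEOREMS ONLY (no `def`, no instance,
no notation, no named fact, no `sorry`); imports ★ only.
HONEST LABEL: HC_CM is proved only modulo the 7 printed citations (2 remaining named inputs: hLiu418 = stmt-HodgeConjecture-24832, h413 = stmt-HodgeConjecture-24833) — until
rung 0 closes.  Type plumbing of a ★ deduction; proves NOTHING printed; kernel leaves by name UNCHANGED; REL ≠ ★ ≠ BUILT.

THE PARTS, THE MATHEMATICS, THE PINS: as in ★ `R90S9DefiniteAeRigidityCutEngine` (module docstring there), verbatim — DATUM `Γ` (over `TG′`), (14.6.1) `h61 : Γ.thm1461 Transfer TransferH`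
[p. 241] (in place of (S6) `h51` + (S5 ∕ S8) `h62 h38 hexH hH61 hvan hvanH`), (S7) `h64 : Γ.thm1461 … → Γ.sec146_evp ∧ Γ.sec146_partition ∧ Γ.thm1464a` [pp. 242–244], `hD : Γ.DSplit`,
PINS `π′ hm Pξ hA hstring hevp hback` (at the datum: ★ `mPrimeSph_ne_zero`, ★ `aeString_of_ae`, ★ `evpRep_of_ae_of_evp_piXiPrime` (α2), ★ `sgTail_of_ae_of_recordSCD` (α1)).
Conclusion = the (S-G) tail of `hRig` BYTE FOR BYTE.  PROOF (§14.6 pp. 242–244): (S7) at `h61` ⟹ `sec146_evp`, `sec146_partition`, `thm1464a`; `P ↦ π′` lies in some `Π′`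
(partition (iii)); (AE) ⟹ string ⟹ `evpRep π′ Π(ξ)` ⟹ `evp Π′ Π(ξ)` (`sec146_evp` (ii)) ⟹ `Π′ ∈ Π_a(G′)`; `thm1464a` ⟹ `Π′ = Π′(ξ′)`; `hback`.  Axioms TRIO.

[cite: Rogawski1990, §14.6 Thm. 14.6.1 (14.6.1) p. 241, p. 242 (e.v.p., `Π(G′)`, (14.6.2)), Thm. 14.6.4 (14.6.3) p. 244; §14.5 Thm. 14.5.1 (b) p. 238; §13.3 Thm. 13.3.5 p. 202, p. 201; §13.6 Props. 13.6.1–13.6.2 pp. 208–210, p. 209 (e.v.p.); §13.1 Prop. 13.1.3 (d), Prop. 13.1.4 p. 199; §12.2 (2) p. 174]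
[cite: FlathCorvallis1979, Thm. 3] [cite: CartierCorvallis1979, §IV.1 Cor. 4.1]
-/

set_option autoImplicit false
-- the mandated namespace repeats `HodgeConjecture.HodgeConjecture`, as in every `Theorems/*.lean` of this sub-problem
set_option linter.dupNamespace false

noncomputable section

open NumberField IsDedekindDomain MeasureTheory
open scoped Matrix ComplexOrder

open Literature.NumberTheory Literature.NumberTheory.Automorphic Literature.NumberTheory.Automorphic.UnitaryGroup
open Literature.NumberTheory.Automorphic.IdeleClassGroup
open Literature.NumberTheory.GaloisRepresentations
open Literature.NumberTheory.Rogawski1990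

namespace Summit.HodgeConjecture.HodgeConjecture.R90.S9

open Summit.HodgeConjecture.HodgeConjecture.Cruxes.H413.F0P3ClassTokenChoice (clFinChoice)
open Summit.HodgeConjecture.HodgeConjecture.Cruxes.H413.F0P3XiLocalFamilyOfRecord (xiFamilyOfRecord)
open Summit.HodgeConjecture.HodgeConjecture.Cruxes.H413.K2E1EvpOfAutomorphicClass (evpAtIntegralLevel)

universe u v

open scoped Classical in
set_option synthInstance.maxHeartbeats 400000 in
set_option maxHeartbeats 8000000 in
/-- **ENGINE `definiteAeRigidityAt_of_thm1461′` — (AE-ⅱ) AT ONE INSTANCE FROM (14.6.1) AND ITS §14.6 CONSEQUENCES, ROUTE-AGNOSTIC** (= ★ `definiteAeRigidityAt_of_parts′` (p862472) with the twelve route binders `SθG SθH h51 PSVanish PSVanishH MatchH h62 h38 hexH hH61 hvan hvanH` replaced by the single `(h61 : Γ.thm1461 Transfer TransferH)` they produce; every other byte unchanged; R90-IF-plan (g2) J8-R2, deal (δ6s) (S1)).  Instance binders = the `hRig` prefix of ★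
`definiteXiMembership_of_ch14` that the texts mention (`L H hH hHd`, the measurable frames, `Δ mH mG νG νH`, `μω hμu`, the SIGNED package `hQS`, `ξ μA P`) and the hypothesis (AE)
«`t(P) = t(Π(ξ))` kit-free» (TEXT = `hRig`'s (AE) clause BYTE FOR BYTE).  Parts: the datum `Γ` over an arbitrary `G′`-test type `TG′` with `Transfer ∕ TransferH`; (14.6.1)
`h61 : Γ.thm1461 Transfer TransferH` [p. 241] — from the STABLE route (★ `Ch14Bridge.thm1461_of_thm1451b hG hH hvan hvanH h51`, Prop. 13.6.1-readings on both sides + Thm. 14.5.1 (b))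
or from the 13.6.2 route (★ `Ch14Bridge.thm1461_of_thm1451b_of_prop1362`), the engine no longer cares; (S7) `h64 : Γ.thm1461 … → Γ.sec146_evp ∧ Γ.sec146_partition ∧ Γ.thm1464a`
[pp. 242–244] and `hD : Γ.DSplit`; PINS `π′ hm Pξ hA`, `hstring : (AE) → ‹E1 string›` (★ `evpAtIntegralLevel`; S1 ∕ Flath), `hevp : ‹E1 string› → Γ.evpRep π′ Pξ`, `hback`
(Thm. 14.6.4's unique `ξ` + `Π′(ξ_v) = {πⁿ, πˢ}(ξ_v)` read in D6 currency, `πˢ ∘ e` = the `hQS`-witness).  Conclusion = `hRig`'s (S-G) tail BYTE FOR BYTE: at every non-split finite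
`v`, every frame `(T, a)` and Keys labels `(π², πⁿ)` with `πⁿ` not `L²`, every `v`-constituent of `P` is `πⁿ ∘ e ∨ π² ∘ e ∨ ((hQS ξ).1 v …).πs`.  Proof: `sec146_partition` (iii),
`sec146_evp` (ii), `thm1464a`, `hback` — Rogawski's §14.6 deduction from (14.6.1), kernel-checked; no `sorry`; axioms `propext`, `Classical.choice`, `Quot.sound`.
[cite: Rogawski1990, §14.6 Thm. 14.6.1 p. 241, p. 242, Thm. 14.6.4 p. 244; §14.5 Thm. 14.5.1 (b) p. 238; §13.3 Thm. 13.3.5 p. 202; §13.6 p. 209; §13.1 Prop. 13.1.3 (d), 13.1.4 p. 199] [cite: FlathCorvallis1979, Thm. 3] -/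
theorem definiteAeRigidityAt_of_thm1461'
    (L : Type) [Field L] [NumberField L] [IsCMField L] (H : Matrix (Fin 3) (Fin 3) L)
    (hH : (H.map (cmConjRingHom L))ᵀ = H) (hHd : IsUnit H.det)
    [∀ v : HeightOneSpectrum (𝓞 ↥(maximalRealSubfield L)), MeasurableSpace ((cmDatum L 3 H).Local v)]
    [∀ v : HeightOneSpectrum (𝓞 ↥(maximalRealSubfield L)),
      MeasurableSpace ((cmDatum L 2 (Matrix.of fun i j : Fin 2 => if i.val + j.val + 1 = 2 then (1 : L) else 0)).Local v ×
        (cmDatum L 1 (Matrix.of fun i j : Fin 1 => if i.val + j.val + 1 = 1 then (1 : L) else 0)).Local v)]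
    [∀ (v : HeightOneSpectrum (𝓞 ↥(maximalRealSubfield L)))
        (a : ((cmDatum L 2 (Matrix.of fun i j : Fin 2 => if i.val + j.val + 1 = 2 then (1 : L) else 0)).Local v ×
          (cmDatum L 1 (Matrix.of fun i j : Fin 1 => if i.val + j.val + 1 = 1 then (1 : L) else 0)).Local v)),
      MeasurableSpace (((cmDatum L 2 (Matrix.of fun i j : Fin 2 => if i.val + j.val + 1 = 2 then (1 : L) else 0)).Local v ×
          (cmDatum L 1 (Matrix.of fun i j : Fin 1 => if i.val + j.val + 1 = 1 then (1 : L) else 0)).Local v) ⧸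
        Subgroup.centralizer ({a} : Set ((cmDatum L 2 (Matrix.of fun i j : Fin 2 => if i.val + j.val + 1 = 2 then (1 : L) else 0)).Local v ×
          (cmDatum L 1 (Matrix.of fun i j : Fin 1 => if i.val + j.val + 1 = 1 then (1 : L) else 0)).Local v)))]
    [∀ (v : HeightOneSpectrum (𝓞 ↥(maximalRealSubfield L))) (γ : (cmDatum L 3 H).Local v),
      MeasurableSpace ((cmDatum L 3 H).Local v ⧸ Subgroup.centralizer ({γ} : Set ((cmDatum L 3 H).Local v)))]
    (Δ : ∀ v : HeightOneSpectrum (𝓞 ↥(maximalRealSubfield L)), LocalTransferFactor L H v)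
    (mH : ∀ v : HeightOneSpectrum (𝓞 ↥(maximalRealSubfield L)),
      OrbitalMeasureFamily ((cmDatum L 2 (Matrix.of fun i j : Fin 2 => if i.val + j.val + 1 = 2 then (1 : L) else 0)).Local v ×
        (cmDatum L 1 (Matrix.of fun i j : Fin 1 => if i.val + j.val + 1 = 1 then (1 : L) else 0)).Local v))
    (mG : ∀ v : HeightOneSpectrum (𝓞 ↥(maximalRealSubfield L)), OrbitalMeasureFamily ((cmDatum L 3 H).Local v))
    (νG : ∀ v : HeightOneSpectrum (𝓞 ↥(maximalRealSubfield L)), Measure ((cmDatum L 3 H).Local v))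
    (νH : ∀ v : HeightOneSpectrum (𝓞 ↥(maximalRealSubfield L)),
      Measure ((cmDatum L 2 (Matrix.of fun i j : Fin 2 => if i.val + j.val + 1 = 2 then (1 : L) else 0)).Local v ×
        (cmDatum L 1 (Matrix.of fun i j : Fin 1 => if i.val + j.val + 1 = 1 then (1 : L) else 0)).Local v))
    [∀ v : HeightOneSpectrum (𝓞 ↥(maximalRealSubfield L)), BorelSpace ((cmDatum L 3 H).Local v)]
    [∀ v : HeightOneSpectrum (𝓞 ↥(maximalRealSubfield L)),
      BorelSpace ((cmDatum L 2 (Matrix.of fun i j : Fin 2 => if i.val + j.val + 1 = 2 then (1 : L) else 0)).Local v ×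
        (cmDatum L 1 (Matrix.of fun i j : Fin 1 => if i.val + j.val + 1 = 1 then (1 : L) else 0)).Local v)]
    [∀ (v : HeightOneSpectrum (𝓞 ↥(maximalRealSubfield L)))
        (a : ((cmDatum L 2 (Matrix.of fun i j : Fin 2 => if i.val + j.val + 1 = 2 then (1 : L) else 0)).Local v ×
          (cmDatum L 1 (Matrix.of fun i j : Fin 1 => if i.val + j.val + 1 = 1 then (1 : L) else 0)).Local v)),
      BorelSpace (((cmDatum L 2 (Matrix.of fun i j : Fin 2 => if i.val + j.val + 1 = 2 then (1 : L) else 0)).Local v ×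
          (cmDatum L 1 (Matrix.of fun i j : Fin 1 => if i.val + j.val + 1 = 1 then (1 : L) else 0)).Local v) ⧸
        Subgroup.centralizer ({a} : Set ((cmDatum L 2 (Matrix.of fun i j : Fin 2 => if i.val + j.val + 1 = 2 then (1 : L) else 0)).Local v ×
          (cmDatum L 1 (Matrix.of fun i j : Fin 1 => if i.val + j.val + 1 = 1 then (1 : L) else 0)).Local v)))]
    [∀ (v : HeightOneSpectrum (𝓞 ↥(maximalRealSubfield L))) (γ : (cmDatum L 3 H).Local v),
      BorelSpace ((cmDatum L 3 H).Local v ⧸ Subgroup.centralizer ({γ} : Set ((cmDatum L 3 H).Local v)))]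
    [∀ v, (νG v).IsHaarMeasure] [∀ v, (νG v).IsMulRightInvariant] [∀ v, (νH v).IsHaarMeasure] [∀ v, (νH v).IsMulRightInvariant]
    (μω : HeckeCharacter L) (hμu : μω.IsUnitary)
    (hQS : CMCharIdentityPackageTestSigned L H hH hHd νH νG μω hμu Δ mH mG)
    (ξ : OneDimAutRepH L)
    (μA : Measure (adelicGroupData (↥(maximalRealSubfield L)) L (IsCMField.complexConj L) 3 H).automorphicQuotient)
    [(adelicGroupData (↥(maximalRealSubfield L)) L (IsCMField.complexConj L) 3 H).IsAutomorphicMeasure μA]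
    (P : DiscreteAutomorphicRep (adelicGroupData (↥(maximalRealSubfield L)) L (IsCMField.complexConj L) 3 H) μA)
    (hAE :
      (∃ S : Finset (HeightOneSpectrum (𝓞 ↥(maximalRealSubfield L))),
        (∀ v : HeightOneSpectrum (𝓞 ↥(maximalRealSubfield L)), v ∉ S →
          ∀ (hns : ∀ w : PlacesOver L v, IsCMField.complexConj L • w.1 = w.1)
            (T : GL (Fin 3) (LocalRing L v)) (a : LocalRing L v) (ha : IsUnit a)
            (h : formCongr (conjLocal L (IsCMField.complexConj L) v) T (H.map (algebraMap L (LocalRing L v))) =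
              a • (Matrix.of fun i j : Fin 3 => if i.val + j.val + 1 = 3 then (1 : L) else 0).map (algebraMap L (LocalRing L v))),
          ∀ [MeasurableSpace (Gqs L v ⧸ Subgroup.center (Gqs L v))] [BorelSpace (Gqs L v ⧸ Subgroup.center (Gqs L v))]
            (μZ : Measure (Gqs L v ⧸ Subgroup.center (Gqs L v))) [μZ.IsHaarMeasure],
          ∀ (π2 πn : IrrClass (Gqs L v)),
            KeysCaseTwoLabels L v (μω.semilocalComponent L v) (torusLocalComponent L (IsCMField.complexConj L) v ξ.η)
              (torusLocalComponent L (IsCMField.complexConj L) v ξ.ψ) π2 πn →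
            ¬ πn.IsSquareIntegrable μZ →
            ∀ c : IrrClass ((cmDatum L 3 H).Local v),
              (IrrClass.comap (localPiEquiv L (IsCMField.complexConj L) 3 H v) c).IsConstituentOf
                  (P.finRep.smoothPart.toRepresentation.comp (inclPlace (↥(maximalRealSubfield L)) L (IsCMField.complexConj L) 3 H v)) →
              c = IrrClass.comap (cmDatumLocalCongr L v T ha h).symm πn) ∧
        (∀ v : HeightOneSpectrum (𝓞 ↥(maximalRealSubfield L)), v ∉ S →
          ∀ (hs : ∃ w : PlacesOver L v, IsCMField.complexConj L • w.1 ≠ w.1),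
            ∀ c : IrrClass ((cmDatum L 3 H).Local v),
              (IrrClass.comap (localPiEquiv L (IsCMField.complexConj L) 3 H v) c).IsConstituentOf
                  (P.finRep.smoothPart.toRepresentation.comp (inclPlace (↥(maximalRealSubfield L)) L (IsCMField.complexConj L) 3 H v)) →
              c ∈ (cmSplitPacket L H hH hHd v (splitWitness v hs) (splitWitness_spec v hs) (ξ.splitν₀ μω (splitWitness v hs).1)
                (ξ.locψ (splitWitness v hs).1) (ξ.norm_splitν₀_apply hμu (splitWitness v hs).1)
                (ξ.continuous_splitν₀ μω (splitWitness v hs).1) (ξ.norm_locψ_apply (splitWitness v hs).1)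
                (ξ.continuous_locψ (splitWitness v hs).1)).members)))
    -- THE §14.6 DATUM over an ARBITRARY `G′`-test type `TG′` (RULING S9-R-TG-2 (W2-a): at `gammaSph … X` it is ★ p862002's pure-tensor PAIR type)
    {TG' : Type v} (Γ : Ch14Sec6.GlobalData.{u} TG'
      (CompactlySupportedContinuousMap (cmDatum L 3 (Matrix.of fun i j : Fin 3 => if i.val + j.val + 1 = 3 then (1 : L) else 0)).Adelic ℂ)
      (CompactlySupportedContinuousMap ((cmDatum L 2 (Matrix.of fun i j : Fin 2 => if i.val + j.val + 1 = 2 then (1 : L) else 0)).Adelic × (cmDatum L 1 (Matrix.of fun i j : Fin 1 => if i.val + j.val + 1 = 1 then (1 : L) else 0)).Adelic) ℂ))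
    (Transfer : TG' →
      (CompactlySupportedContinuousMap (cmDatum L 3 (Matrix.of fun i j : Fin 3 => if i.val + j.val + 1 = 3 then (1 : L) else 0)).Adelic ℂ) → Prop)
    (TransferH : TG' →
      (CompactlySupportedContinuousMap ((cmDatum L 2 (Matrix.of fun i j : Fin 2 => if i.val + j.val + 1 = 2 then (1 : L) else 0)).Adelic × (cmDatum L 1 (Matrix.of fun i j : Fin 1 => if i.val + j.val + 1 = 1 then (1 : L) else 0)).Adelic) ℂ) → Prop)
    -- (14.6.1) AT THE DATUM — «Tr r(f′) = SΘ-expansion» on transfers [p. 241]; ANY producer (stable route ★ `Ch14Bridge.thm1461_of_thm1451b`, 13.6.2 route ★ `…_of_prop1362`)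
    (h61 : Γ.thm1461 Transfer TransferH)
    -- (S7) §14.6 for `D = M₃(E)`: (14.6.1) ⟹ the e.v.p. classification, the partition of `Π(G′)` and Thm. 14.6.4 (first sentence), at the datum
    (h64 : Γ.thm1461 Transfer TransferH → Γ.sec146_evp ∧ Γ.sec146_partition ∧ Γ.thm1464a)
    (hD : Γ.DSplit)
    -- PINS (readings of `P`, `Π(ξ)` in the datum; E1 ∕ S1 ∕ S3 ∕ S2)
    (π' : Γ.Rep') (hm : Γ.m' π' ≠ 0)
    (Pξ : Γ.G.Packet) (hA : Γ.G.IsAPacket Pξ)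
    (hstring :
      (∃ S : Finset (HeightOneSpectrum (𝓞 ↥(maximalRealSubfield L))),
        (∀ v : HeightOneSpectrum (𝓞 ↥(maximalRealSubfield L)), v ∉ S →
          ∀ (hns : ∀ w : PlacesOver L v, IsCMField.complexConj L • w.1 = w.1)
            (T : GL (Fin 3) (LocalRing L v)) (a : LocalRing L v) (ha : IsUnit a)
            (h : formCongr (conjLocal L (IsCMField.complexConj L) v) T (H.map (algebraMap L (LocalRing L v))) =
              a • (Matrix.of fun i j : Fin 3 => if i.val + j.val + 1 = 3 then (1 : L) else 0).map (algebraMap L (LocalRing L v))),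
          ∀ [MeasurableSpace (Gqs L v ⧸ Subgroup.center (Gqs L v))] [BorelSpace (Gqs L v ⧸ Subgroup.center (Gqs L v))]
            (μZ : Measure (Gqs L v ⧸ Subgroup.center (Gqs L v))) [μZ.IsHaarMeasure],
          ∀ (π2 πn : IrrClass (Gqs L v)),
            KeysCaseTwoLabels L v (μω.semilocalComponent L v) (torusLocalComponent L (IsCMField.complexConj L) v ξ.η)
              (torusLocalComponent L (IsCMField.complexConj L) v ξ.ψ) π2 πn →
            ¬ πn.IsSquareIntegrable μZ →
            ∀ c : IrrClass ((cmDatum L 3 H).Local v),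
              (IrrClass.comap (localPiEquiv L (IsCMField.complexConj L) 3 H v) c).IsConstituentOf
                  (P.finRep.smoothPart.toRepresentation.comp (inclPlace (↥(maximalRealSubfield L)) L (IsCMField.complexConj L) 3 H v)) →
              c = IrrClass.comap (cmDatumLocalCongr L v T ha h).symm πn) ∧
        (∀ v : HeightOneSpectrum (𝓞 ↥(maximalRealSubfield L)), v ∉ S →
          ∀ (hs : ∃ w : PlacesOver L v, IsCMField.complexConj L • w.1 ≠ w.1),
            ∀ c : IrrClass ((cmDatum L 3 H).Local v),
              (IrrClass.comap (localPiEquiv L (IsCMField.complexConj L) 3 H v) c).IsConstituentOf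
                  (P.finRep.smoothPart.toRepresentation.comp (inclPlace (↥(maximalRealSubfield L)) L (IsCMField.complexConj L) 3 H v)) →
              c ∈ (cmSplitPacket L H hH hHd v (splitWitness v hs) (splitWitness_spec v hs) (ξ.splitν₀ μω (splitWitness v hs).1)
                (ξ.locψ (splitWitness v hs).1) (ξ.norm_splitν₀_apply hμu (splitWitness v hs).1)
                (ξ.continuous_splitν₀ μω (splitWitness v hs).1) (ξ.norm_locψ_apply (splitWitness v hs).1)
                (ξ.continuous_locψ (splitWitness v hs).1)).members)) →
        (∃ S₀ : Finset (HeightOneSpectrum (𝓞 ↥(maximalRealSubfield L))),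
                    ∀ (S : Set (HeightOneSpectrum (𝓞 ↥(maximalRealSubfield L)))), (↑S₀ : Set _) ⊆ S →
                      ∀ (hP : ∀ v, v ∉ S → (clFinChoice P v).IsSpherical (cmLocalIntegralLevel L 3 H v))
                        (hξ : ∀ v, v ∉ S → (xiFamilyOfRecord L H hH hHd μω hμu ξ v).πn.IsSpherical (cmLocalIntegralLevel L 3 H v)),
                        evpAtIntegralLevel L 3 H (fun v => clFinChoice P v) S hP =
                          evpAtIntegralLevel L 3 H (fun v => (xiFamilyOfRecord L H hH hHd μω hμu ξ v).πn) S hξ))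
    (hevp :
        (∃ S₀ : Finset (HeightOneSpectrum (𝓞 ↥(maximalRealSubfield L))),
                    ∀ (S : Set (HeightOneSpectrum (𝓞 ↥(maximalRealSubfield L)))), (↑S₀ : Set _) ⊆ S →
                      ∀ (hP : ∀ v, v ∉ S → (clFinChoice P v).IsSpherical (cmLocalIntegralLevel L 3 H v))
                        (hξ : ∀ v, v ∉ S → (xiFamilyOfRecord L H hH hHd μω hμu ξ v).πn.IsSpherical (cmLocalIntegralLevel L 3 H v)),
                        evpAtIntegralLevel L 3 H (fun v => clFinChoice P v) S hP =
                          evpAtIntegralLevel L 3 H (fun v => (xiFamilyOfRecord L H hH hHd μω hμu ξ v).πn) S hξ) →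
        Γ.evpRep π' Pξ)
    (hback : ∀ (ξ' : Γ.G.PacketH) (h₁ : Γ.IsOneDimH ξ') (hS : ∀ v, v ∈ Γ.S₀ → Γ.MnNeZero ξ' v),
      Γ.evp (Γ.PiXi' ξ' h₁ hS) Pξ → Γ.mem' π' (Γ.PiXi' ξ' h₁ hS) →
        ∀ (v : HeightOneSpectrum (𝓞 ↥(maximalRealSubfield L))) (hns : ∀ w : PlacesOver L v, IsCMField.complexConj L • w.1 = w.1),
        ∀ (T : GL (Fin 3) (LocalRing L v)) (a : LocalRing L v) (ha : IsUnit a)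
          (h : formCongr (conjLocal L (IsCMField.complexConj L) v) T (H.map (algebraMap L (LocalRing L v))) =
            a • (Matrix.of fun i j : Fin 3 => if i.val + j.val + 1 = 3 then (1 : L) else 0).map (algebraMap L (LocalRing L v))),
        ∀ [MeasurableSpace (Gqs L v ⧸ Subgroup.center (Gqs L v))] [BorelSpace (Gqs L v ⧸ Subgroup.center (Gqs L v))]
          (μZ : Measure (Gqs L v ⧸ Subgroup.center (Gqs L v))) [μZ.IsHaarMeasure],
        ∀ (π2 πn : IrrClass (Gqs L v)),
        ∀ (hK : KeysCaseTwoLabels L v (μω.semilocalComponent L v) (torusLocalComponent L (IsCMField.complexConj L) v ξ.η)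
            (torusLocalComponent L (IsCMField.complexConj L) v ξ.ψ) π2 πn)
          (hn : ¬ πn.IsSquareIntegrable μZ),
          -- (S-G) «13.3.6 (c) ∕ §14.6 AT PRINT'S PINNED DATA»: every v-constituent of P is πⁿ ∘ e, π² ∘ e, or the πˢ(ξ_v) ∘ e of `hQS`
          ∀ c : IrrClass ((cmDatum L 3 H).Local v),
            (IrrClass.comap (localPiEquiv L (IsCMField.complexConj L) 3 H v) c).IsConstituentOf
                (P.finRep.smoothPart.toRepresentation.comp (inclPlace (↥(maximalRealSubfield L)) L (IsCMField.complexConj L) 3 H v)) →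
            c = IrrClass.comap (cmDatumLocalCongr L v T ha h).symm πn ∨
              c = IrrClass.comap (cmDatumLocalCongr L v T ha h).symm π2 ∨
              c = ((hQS ξ).1 v hns T a ha h μZ π2 πn hK hn).πs) :
      ∀ (v : HeightOneSpectrum (𝓞 ↥(maximalRealSubfield L))) (hns : ∀ w : PlacesOver L v, IsCMField.complexConj L • w.1 = w.1),
      ∀ (T : GL (Fin 3) (LocalRing L v)) (a : LocalRing L v) (ha : IsUnit a)
        (h : formCongr (conjLocal L (IsCMField.complexConj L) v) T (H.map (algebraMap L (LocalRing L v))) =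
          a • (Matrix.of fun i j : Fin 3 => if i.val + j.val + 1 = 3 then (1 : L) else 0).map (algebraMap L (LocalRing L v))),
      ∀ [MeasurableSpace (Gqs L v ⧸ Subgroup.center (Gqs L v))] [BorelSpace (Gqs L v ⧸ Subgroup.center (Gqs L v))]
        (μZ : Measure (Gqs L v ⧸ Subgroup.center (Gqs L v))) [μZ.IsHaarMeasure],
      ∀ (π2 πn : IrrClass (Gqs L v)),
      ∀ (hK : KeysCaseTwoLabels L v (μω.semilocalComponent L v) (torusLocalComponent L (IsCMField.complexConj L) v ξ.η)
          (torusLocalComponent L (IsCMField.complexConj L) v ξ.ψ) π2 πn)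
        (hn : ¬ πn.IsSquareIntegrable μZ),
        -- (S-G) «13.3.6 (c) ∕ §14.6 AT PRINT'S PINNED DATA»: every v-constituent of P is πⁿ ∘ e, π² ∘ e, or the πˢ(ξ_v) ∘ e of `hQS`
        ∀ c : IrrClass ((cmDatum L 3 H).Local v),
          (IrrClass.comap (localPiEquiv L (IsCMField.complexConj L) 3 H v) c).IsConstituentOf
              (P.finRep.smoothPart.toRepresentation.comp (inclPlace (↥(maximalRealSubfield L)) L (IsCMField.complexConj L) 3 H v)) →
          c = IrrClass.comap (cmDatumLocalCongr L v T ha h).symm πn ∨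
            c = IrrClass.comap (cmDatumLocalCongr L v T ha h).symm π2 ∨
            c = ((hQS ξ).1 v hns T a ha h μZ π2 πn hK hn).πs := by
  intro v hns T a ha h _ _ μZ _ π2 πn hK hn c hc
  -- (S7) ⟹ e.v.p. classification + partition + Thm. 14.6.4 (a)
  obtain ⟨hevp', hpart, h64a⟩ := h64 h61
  -- `P` occurs discretely, hence lies in a global L-packet `Π′` of `G′` [§14.6 p. 242]
  obtain ⟨P', hmem⟩ := hpart.2.2 π' hm
  -- (AE) ⟹ `t(P) = t(Π(ξ))` (E1 string) ⟹ `t(Π′) = t(Π(ξ))`, so `Π′ ∈ Π_a(G′)` [§14.6 p. 242]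
  have hevpP : Γ.evp P' Pξ := (hevp'.2 π' P' Pξ hmem).1 (hevp (hstring hAE))
  have hInA : Γ.InA' P' := ⟨⟨π', hmem, hm⟩, Pξ, hevpP, hA⟩
  -- Thm. 14.6.4 (first sentence): `Π′ = Π′(ξ′)` [p. 244]; read back locally (pin)
  obtain ⟨ξ', h₁, hS, hP'⟩ := h64a hD P' hInA
  subst hP'
  exact hback ξ' h₁ hS hevpP hmem v hns T a ha h μZ π2 πn hK hn c hc

end Summit.HodgeConjecture.HodgeConjecture.R90.S9

end
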